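import Summits.SmoothPoincare4.SmoothPoincare4.Theorems.SblfDescentRungOneHelperAnnTwistMaps
import Summits.SmoothPoincare4.SmoothPoincare4.Theorems.SblfDescentRungOneHelperAnnSmale
import Summits.SmoothPoincare4.SmoothPoincare4.Theorems.SblfDescentRungOneHelperAnnCore
import Literature.Topology.FourManifolds.KnotsInBall
import Mathlib.Analysis.SpecialFunctions.SmoothTransition
import HarnessLib

/-!
# The mapping class group of the annulus is generated by the Dehn twist — stub
# `helper_sliceGluing_annulusTwist` of line `Sketch`, crux `SblfDescent.RungOne`

(Crux item stmt-SmoothPoincare4-18531; skeleton `Cruxes/RungOne/Lines/Sketch.lean`.)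

**Theorem** (`helper_sliceGluing_annulusTwist`). Let `ψ` be a diffeomorphism of `ℝ²` (smooth,
with smooth inverse `ψ'`) equal to the identity on the disc `‖z‖ ≤ 5/4` and off the disc of radius
`7/4` — a diffeomorphism of the annulus `5/4 ≤ ‖z‖ ≤ 7/4` fixed near its boundary.  Then for some
integer `k` there are jointly smooth, mutually inverse families `H_t`, `H_t⁻¹` of diffeomorphisms of
`ℝ²` with `H_0 = ψ`, `H_1 = D_k` the `k`-th Dehn twist power
`z ↦ R(2πk · smoothTransition (2 (‖z‖ - 5/4))) z`, and `H_t = id` on `‖z‖ ≤ 9/8` and on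
`‖z‖ ≥ 15/8` for all `t`: **`π₀ Diff(A rel ∂A)` is generated by the Dehn twist** (Farb–Margalit,
*A primer on mapping class groups* (2012), Prop. 2.4 for the homotopy form; the smooth isotopy form
rests on Smale's theorem `π₀ Diff(D² rel ∂) = 0`).

**Proof.** Layer 4 (`AnnulusTwist.exists_iso_rel_smallDisc`, the fibration
`Diff_c(ℝ²) → Emb(D², ℝ²)` made concrete through Smale's theorem, the winding number of the `1`-jet
loop and the loop realisation theorem) joins a rescaled copy `ψ_λ = δ_λ ψ δ_λ⁻¹` to a twist power
`D_k` through compactly supported diffeomorphisms fixing a SMALL disc `‖z‖ ≤ δ`.  The present file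
upgrades "rel a small disc" to "rel the disc of radius `9/8`" by an Alexander-type conjugation:
the straight-line contraction `z ↦ (1 - σ(t)(1 - 1/K)) z` of the disc `‖z‖ ≤ 9/8` extends
(tree `exists_ambientIsotopy_of_hasDerivAt`, Hirsch's isotopy extension by cut-off and
integration) to a compactly supported ambient isotopy `Φ_t` of the disc of radius `1.8`; with
`h = Φ_1⁻¹` (which is the homothety of ratio `K` on the disc of radius `9/(8K) ≤ δ`) the conjugate
family `h F_t h⁻¹` fixes the disc of radius `9/8`, and so do the correction families
`Φ_s⁻¹ ∘ g ∘ Φ_s` for `g = ψ, D_k` (which fix the disc of radius `5/4 ≥ 9/8`, mapped into itself by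
`Φ_s`) and the conjugate `h S_s h⁻¹` of the rescaling path `S_s = δ_{m(s)} ψ δ_{m(s)}⁻¹` from `ψ_λ`
to `ψ`.  Concatenating (smoothly, with plateaux) gives the isotopy from `ψ` to `D_k` rel the disc of
radius `9/8` and rel `‖z‖ ≥ 15/8`.

## References

* B. Farb, D. Margalit, *A primer on mapping class groups*, PMS 49 (2012), Prop. 2.4, §3.1.1.
  [FarbMargalit2012]
* J. Cerf, *Sur les difféomorphismes de la sphère de dimension trois (Γ₄ = 0)*, LNM 53 (1968),
  Appendice §5, Proposition 4, Théorème 4. [CerfDiffeoSphere1968]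
* M. W. Hirsch, *Differential Topology*, GTM 33 (1976), Ch. 8 §1, Thms. 1.2–1.4. [HirschDT1976]
-/

set_option linter.dupNamespace false

noncomputable section

open scoped Manifold ContDiff Topology RealInnerProductSpace
open Set Function Literature.Topology.FourManifolds

namespace Summit.SmoothPoincare4.SmoothPoincare4.Cruxes.RungOne.Sketch

/-- Local notation: `𝔼 n` is the model Euclidean space `EuclideanSpace ℝ (Fin n)`. -/
local notation "𝔼 " n:arg => EuclideanSpace ℝ (Fin n)

namespace AnnulusTwist

open Metric Filter

/-! ### The blow-up family -/

/-- **The straight-line contraction of the disc `‖z‖ ≤ 9/8` extends to a compactly supported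
ambient isotopy of the disc of radius `1.8`**: for `K ≥ 1` there are jointly smooth, mutually
inverse families `Φ_t`, `Φ_t⁻¹` of self-maps of `ℝ²`, the identity off the disc of radius `1.8`,
with `Φ_t z = (1 - σ(t) (1 - K⁻¹)) z` for `‖z‖ ≤ 9/8` and `t ∈ [0, 1]` (`σ` Mathlib's smooth
transition), `Φ_0 = id`. [cite: HirschDT1976, Ch. 8 §1, Thms. 1.2–1.4] -/
theorem exists_blowup {K : ℝ} (hK : 1 ≤ K) :
    ∃ Φ Φinv : ℝ → EuclideanSpace ℝ (Fin 2) → EuclideanSpace ℝ (Fin 2),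
      ContDiff ℝ ∞ (uncurry Φ) ∧ ContDiff ℝ ∞ (uncurry Φinv) ∧
      (∀ t z, Φ t (Φinv t z) = z) ∧ (∀ t z, Φinv t (Φ t z) = z) ∧ (∀ z, Φ 0 z = z) ∧
      (∀ t z, (9 : ℝ) / 5 ≤ ‖z‖ → Φ t z = z) ∧
      (∀ t ∈ Icc (0 : ℝ) 1, ∀ z, ‖z‖ ≤ 9 / 8 →
        Φ t z = (1 - Real.smoothTransition t * (1 - K⁻¹)) • z) := by
  have hKpos : 0 < K := by linarith
  have hK1 : 0 ≤ 1 - K⁻¹ := by rw [sub_nonneg]; exact inv_le_one_of_one_le₀ hK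
  -- the profile `m t = 1 - σ t (1 - 1/K) ∈ [1/K, 1]` and its derivative
  set σ := Real.smoothTransition with hσ
  have hσs : ContDiff ℝ ∞ σ := Real.smoothTransition.contDiff
  have hσd : ∀ t, HasDerivAt σ (deriv σ t) t := fun t =>
    ((hσs.differentiable (by simp)) t).hasDerivAt
  have hσ's : ContDiff ℝ ∞ (deriv σ) := (contDiff_infty_iff_deriv.1 hσs).2
  set m : ℝ → ℝ := fun t => 1 - σ t * (1 - K⁻¹) with hm
  have hms : ContDiff ℝ ∞ m := contDiff_const.sub (hσs.mul contDiff_const)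
  have hmd : ∀ t, HasDerivAt m (-(deriv σ t * (1 - K⁻¹))) t := fun t =>
    ((hσd t).mul_const (1 - K⁻¹)).const_sub 1
  have hmlow : ∀ t, K⁻¹ ≤ m t := fun t => by
    have : σ t * (1 - K⁻¹) ≤ 1 * (1 - K⁻¹) :=
      mul_le_mul_of_nonneg_right (Real.smoothTransition.le_one t) hK1
    simp only [hm]; linarith
  have hmpos : ∀ t, 0 < m t := fun t => (inv_pos.2 hKpos).trans_le (hmlow t)
  have hmle : ∀ t, m t ≤ 1 := fun t => by
    have : 0 ≤ σ t * (1 - K⁻¹) := mul_nonneg (Real.smoothTransition.nonneg t) hK1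
    simp only [hm]; linarith
  have hm0 : m 0 = 1 := by simp [hm, hσ]
  -- the velocity field `Y (t, y) = (m' t / m t) y`
  set Y : ℝ × EuclideanSpace ℝ (Fin 2) → EuclideanSpace ℝ (Fin 2) :=
    fun p => (-(deriv σ p.1 * (1 - K⁻¹)) / m p.1) • p.2 with hY
  have hYs : ContDiff ℝ ∞ Y := by
    have hcoef : ContDiff ℝ ∞ fun p : ℝ × EuclideanSpace ℝ (Fin 2) =>
        -(deriv σ p.1 * (1 - K⁻¹)) / m p.1 :=
      ((hσ's.comp contDiff_fst).mul contDiff_const).neg.div (hms.comp contDiff_fst)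
        fun p => (hmpos p.1).ne'
    exact hcoef.smul contDiff_snd
  -- the trajectories `t ↦ m t • x`, `‖x‖ ≤ 9/8`
  set cK : Set (EuclideanSpace ℝ (Fin 2)) := closedBall 0 (9 / 8) with hcK
  set c : cK → ℝ → EuclideanSpace ℝ (Fin 2) := fun x t => m t • (x : EuclideanSpace ℝ (Fin 2)) with hc
  have hcd : ∀ x : cK, ∀ t ∈ Ioo (-1 : ℝ) 2, HasDerivAt (c x) (Y (t, c x t)) t := fun x t _ => by
    have h := (hmd t).smul_const (x : EuclideanSpace ℝ (Fin 2))
    have hYv : Y (t, c x t) = (-(deriv σ t * (1 - K⁻¹))) • (x : EuclideanSpace ℝ (Fin 2)) := by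
      simp only [hY, hc, smul_smul]
      rw [div_mul_cancel₀ _ (hmpos t).ne']
    rw [hYv]; exact h
  have hcmem : ∀ x : cK, ∀ t ∈ Ioo (-1 : ℝ) 2, c x t ∈ cK := fun x t _ => by
    simp only [hc, hcK, mem_closedBall_zero_iff, norm_smul, Real.norm_eq_abs, abs_of_pos (hmpos t)]
    have hx : ‖(x : EuclideanSpace ℝ (Fin 2))‖ ≤ 9 / 8 := mem_closedBall_zero_iff.1 x.2
    nlinarith [hmle t, hmpos t, norm_nonneg (x : EuclideanSpace ℝ (Fin 2))]
  obtain ⟨G, ⟨C, -, hCU, hGC⟩, hG⟩ := exists_ambientIsotopy_of_hasDerivAt hYs hcd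
    (isCompact_closedBall (0 : EuclideanSpace ℝ (Fin 2)) (9 / 8)) isOpen_ball
    (closedBall_subset_ball (by norm_num : (9 : ℝ) / 8 < 9 / 5)) hcmem
  obtain ⟨hGs, hGinvs⟩ := contDiff_of_diffeotopy G.toDiffeotopy
  refine ⟨G.toDiffeotopy.toFun, G.toDiffeotopy.invFun, hGs, hGinvs, G.toDiffeotopy.toFun_invFun,
    G.toDiffeotopy.invFun_toFun, fun z => ?_, fun t z hz => ?_, fun t ht z hz => ?_⟩
  · rw [AmbientIsotopy.toDiffeotopy_toFun, G.map_zero, id]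
  · rw [AmbientIsotopy.toDiffeotopy_toFun]
    exact hGC t z fun h => by have := mem_ball_zero_iff.1 (hCU h); linarith
  · rw [AmbientIsotopy.toDiffeotopy_toFun]
    have h := hG ⟨z, mem_closedBall_zero_iff.2 hz⟩ t ht
    simp only [hc, hm0, one_smul] at h
    rw [h]

/-! ### Concatenation and reversal of isotopies of the annulus -/

/-- **Reversal**: `t ↦ H (1 - t)`. [folklore] -/
theorem iso_symm {H Hi : ℝ → EuclideanSpace ℝ (Fin 2) → EuclideanSpace ℝ (Fin 2)}
    (hs : ContDiff ℝ ∞ (uncurry H)) (his : ContDiff ℝ ∞ (uncurry Hi)) :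
    ContDiff ℝ ∞ (uncurry fun t z => H (1 - t) z) ∧ ContDiff ℝ ∞ (uncurry fun t z => Hi (1 - t) z) :=
  ⟨hs.comp ((contDiff_const.sub contDiff_fst).prodMk contDiff_snd),
    his.comp ((contDiff_const.sub contDiff_fst).prodMk contDiff_snd)⟩

/-- **Concatenation of two isotopies of the plane rel the disc `‖z‖ ≤ 9/8` and rel `‖z‖ ≥ 15/8`**
(jointly smooth families with jointly smooth inverses), the end of the first being the start of the
second: `H_t = H²_{σ(2t-1)} ∘ (H²_0)⁻¹ ∘ H¹_{σ(2t)}` with Mathlib's smooth transition `σ`.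
[cite: HirschDT1976, Ch. 8 §1, p. 178] -/
theorem iso_trans {H₁ H₁i H₂ H₂i : ℝ → EuclideanSpace ℝ (Fin 2) → EuclideanSpace ℝ (Fin 2)}
    (h₁s : ContDiff ℝ ∞ (uncurry H₁)) (h₁is : ContDiff ℝ ∞ (uncurry H₁i))
    (h₁a : ∀ t z, H₁ t (H₁i t z) = z) (h₁b : ∀ t z, H₁i t (H₁ t z) = z)
    (h₁fix : ∀ t z, ‖z‖ ≤ 9 / 8 → H₁ t z = z) (h₁far : ∀ t z, 15 / 8 ≤ ‖z‖ → H₁ t z = z)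
    (h₂s : ContDiff ℝ ∞ (uncurry H₂)) (h₂is : ContDiff ℝ ∞ (uncurry H₂i))
    (h₂a : ∀ t z, H₂ t (H₂i t z) = z) (h₂b : ∀ t z, H₂i t (H₂ t z) = z)
    (h₂fix : ∀ t z, ‖z‖ ≤ 9 / 8 → H₂ t z = z) (h₂far : ∀ t z, 15 / 8 ≤ ‖z‖ → H₂ t z = z)
    (hmatch : ∀ z, H₁ 1 z = H₂ 0 z) :
    ∃ H Hi : ℝ → EuclideanSpace ℝ (Fin 2) → EuclideanSpace ℝ (Fin 2),
      ContDiff ℝ ∞ (uncurry H) ∧ ContDiff ℝ ∞ (uncurry Hi) ∧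
      (∀ t z, H t (Hi t z) = z) ∧ (∀ t z, Hi t (H t z) = z) ∧
      (∀ t z, ‖z‖ ≤ 9 / 8 → H t z = z) ∧ (∀ t z, 15 / 8 ≤ ‖z‖ → H t z = z) ∧
      (∀ z, H 0 z = H₁ 0 z) ∧ (∀ z, H 1 z = H₂ 1 z) := by
  set s₁ : ℝ → ℝ := fun t => Real.smoothTransition (2 * t) with hs₁
  set s₂ : ℝ → ℝ := fun t => Real.smoothTransition (2 * t - 1) with hs₂
  have hs₁s : ContDiff ℝ ∞ s₁ := Real.smoothTransition.contDiff.comp (contDiff_const.mul contDiff_id)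
  have hs₂s : ContDiff ℝ ∞ s₂ :=
    Real.smoothTransition.contDiff.comp ((contDiff_const.mul contDiff_id).sub contDiff_const)
  have hs₁0 : s₁ 0 = 0 := by simp [hs₁]
  have hs₂0 : s₂ 0 = 0 := by
    simp only [hs₂]; exact Real.smoothTransition.zero_of_nonpos (by norm_num)
  have hs₁1 : s₁ 1 = 1 := by
    simp only [hs₁]; exact Real.smoothTransition.one_of_one_le (by norm_num)
  have hs₂1 : s₂ 1 = 1 := by
    simp only [hs₂]; norm_num [Real.smoothTransition.one]
  have h₂ifix : ∀ z : EuclideanSpace ℝ (Fin 2), ‖z‖ ≤ 9 / 8 → H₂i 0 z = z := fun z hz => by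
    conv_lhs => rw [← h₂fix 0 z hz]
    exact h₂b 0 z
  have h₂ifar : ∀ z : EuclideanSpace ℝ (Fin 2), 15 / 8 ≤ ‖z‖ → H₂i 0 z = z := fun z hz => by
    conv_lhs => rw [← h₂far 0 z hz]
    exact h₂b 0 z
  refine ⟨fun t z => H₂ (s₂ t) (H₂i 0 (H₁ (s₁ t) z)), fun t z => H₁i (s₁ t) (H₂ 0 (H₂i (s₂ t) z)),
    ?_, ?_, ?_, ?_, ?_, ?_, ?_, ?_⟩
  · refine h₂s.comp ((hs₂s.comp contDiff_fst).prodMk ?_)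
    refine (h₂is.comp (contDiff_const.prodMk ?_))
    exact h₁s.comp ((hs₁s.comp contDiff_fst).prodMk contDiff_snd)
  · refine h₁is.comp ((hs₁s.comp contDiff_fst).prodMk ?_)
    refine (h₂s.comp (contDiff_const.prodMk ?_))
    exact h₂is.comp ((hs₂s.comp contDiff_fst).prodMk contDiff_snd)
  · intro t z; simp only [h₂a, h₂b, h₁a]
  · intro t z; simp only [h₂a, h₂b, h₁b]
  · intro t z hz; simp only [h₁fix _ z hz, h₂ifix z hz, h₂fix _ z hz]
  · intro t z hz; simp only [h₁far _ z hz, h₂ifar z hz, h₂far _ z hz]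
  · intro z; simp only [hs₁0, hs₂0, h₂a]
  · intro z; simp only [hs₁1, hs₂1, hmatch, h₂b]

/-- **Conjugation pieces.** For a "conjugator" family `A_s` (inverse `A_s⁻¹`, the identity off
the disc of radius `9/5`) and a "core" family `P_t` (inverse `P_t⁻¹`, the identity off the disc of
radius `7/4`), reparametrised by smooth `a`, `b`, the family `A_{a t}⁻¹ ∘ P_{b t} ∘ A_{a t}` is an
isotopy of the plane rel `‖z‖ ≥ 15/8`, and rel the disc `‖z‖ ≤ 9/8` as soon as `P_{b t}` fixes
`A_{a t} z` for `‖z‖ ≤ 9/8`. [folklore] -/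
theorem conj_piece {A Ai P Pi : ℝ → EuclideanSpace ℝ (Fin 2) → EuclideanSpace ℝ (Fin 2)} {a b : ℝ → ℝ}
    (hAs : ContDiff ℝ ∞ (uncurry A)) (hAis : ContDiff ℝ ∞ (uncurry Ai))
    (hAa : ∀ s z, A s (Ai s z) = z) (hAb : ∀ s z, Ai s (A s z) = z)
    (hAfar : ∀ s z, (9 : ℝ) / 5 ≤ ‖z‖ → A s z = z)
    (hPs : ContDiff ℝ ∞ (uncurry P)) (hPis : ContDiff ℝ ∞ (uncurry Pi))
    (hPa : ∀ t z, P t (Pi t z) = z) (hPb : ∀ t z, Pi t (P t z) = z)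
    (hPfar : ∀ t z, (7 : ℝ) / 4 ≤ ‖z‖ → P t z = z)
    (ha : ContDiff ℝ ∞ a) (hb : ContDiff ℝ ∞ b)
    (hfix : ∀ t z, ‖z‖ ≤ 9 / 8 → P (b t) (A (a t) z) = A (a t) z) :
    ContDiff ℝ ∞ (uncurry fun t z => Ai (a t) (P (b t) (A (a t) z))) ∧
      ContDiff ℝ ∞ (uncurry fun t z => Ai (a t) (Pi (b t) (A (a t) z))) ∧
      (∀ t z, Ai (a t) (P (b t) (A (a t) (Ai (a t) (Pi (b t) (A (a t) z))))) = z) ∧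
      (∀ t z, Ai (a t) (Pi (b t) (A (a t) (Ai (a t) (P (b t) (A (a t) z))))) = z) ∧
      (∀ t z, ‖z‖ ≤ 9 / 8 → Ai (a t) (P (b t) (A (a t) z)) = z) ∧
      (∀ t z, 15 / 8 ≤ ‖z‖ → Ai (a t) (P (b t) (A (a t) z)) = z) := by
  have hAifar : ∀ s z, (9 : ℝ) / 5 ≤ ‖z‖ → Ai s z = z := fun s z hz => by
    conv_lhs => rw [← hAfar s z hz]
    exact hAb s z
  refine ⟨?_, ?_, fun t z => ?_, fun t z => ?_, fun t z hz => ?_, fun t z hz => ?_⟩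
  · refine hAis.comp ((ha.comp contDiff_fst).prodMk (hPs.comp ((hb.comp contDiff_fst).prodMk ?_)))
    exact hAs.comp ((ha.comp contDiff_fst).prodMk contDiff_snd)
  · refine hAis.comp ((ha.comp contDiff_fst).prodMk (hPis.comp ((hb.comp contDiff_fst).prodMk ?_)))
    exact hAs.comp ((ha.comp contDiff_fst).prodMk contDiff_snd)
  · rw [hAa, hPa, hAb]
  · rw [hAa, hPb, hAb]
  · rw [hfix t z hz, hAb]
  · rw [hAfar _ z (by linarith), hPfar _ z (by linarith), hAifar _ z (by linarith)]

end AnnulusTwist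

open AnnulusTwist in
/-- **`π₀ Diff(A rel ∂A)` is generated by the Dehn twist, smooth isotopy form** (see the module
docstring): a diffeomorphism of the plane equal to the identity on `‖z‖ ≤ 5/4` and on `‖z‖ ≥ 7/4`
is joined to a Dehn twist power by a jointly smooth family of diffeomorphisms, all equal to the
identity on `‖z‖ ≤ 9/8` and on `‖z‖ ≥ 15/8`. [cite: FarbMargalit2012, Prop. 2.4 and §3.1.1] -/
theorem helper_sliceGluing_annulusTwist : ∀ (ψ ψ' : 𝔼 2 → 𝔼 2), ContDiff ℝ ∞ ψ → ContDiff ℝ ∞ ψ' → (∀ z, ψ (ψ' z) = z) → (∀ z, ψ' (ψ z) = z) → (∀ z, ‖z‖ ≤ 5 / 4 → ψ z = z) → (∀ z, 7 / 4 ≤ ‖z‖ → ψ z = z) → ∃ (k : ℤ) (H Hinv : ℝ → 𝔼 2 → 𝔼 2), ContDiff ℝ ∞ (fun p : ℝ × 𝔼 2 => H p.1 p.2) ∧ ContDiff ℝ ∞ (fun p : ℝ × 𝔼 2 => Hinv p.1 p.2) ∧ (∀ t z, H t (Hinv t z) = z) ∧ (∀ t z, Hinv t (H t z) = z) ∧ (∀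 z, H 0 z = ψ z) ∧ (∀ z, (H 1 z) 0 = Real.cos (2 * Real.pi * k * Real.smoothTransition (2 * (‖z‖ - 5 / 4))) * z 0 - Real.sin (2 * Real.pi * k * Real.smoothTransition (2 * (‖z‖ - 5 / 4))) * z 1 ∧ (H 1 z) 1 = Real.sin (2 * Real.pi * k * Real.smoothTransition (2 * (‖z‖ - 5 / 4))) * z 0 + Real.cos (2 * Real.pi * k * Real.smoothTransition (2 * (‖z‖ - 5 / 4))) * z 1) ∧ (∀ t z, ‖z‖ ≤ 9 / 8 → H t z = z) ∧ (∀ t z, 15 / 8 ≤ ‖z‖ → H t z = z) := by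
  intro ψ ψ' hψ hψ' h1 h2 hfix hsupp
  -- Layer 4: isotopy rel a small disc, at scale `l`
  obtain ⟨k, l, δ, F, Finv, hl, hl1, hδ, hδ1, hFs, hFis, hFa, hFb, hF0, hF1, hFfix, hFfar⟩ :=
    exists_iso_rel_smallDisc ψ ψ' hψ hψ' h1 h2 hfix hsupp
  -- the blow-up ratio `K`
  set K : ℝ := max (9 / (8 * δ)) (9 / (10 * l)) with hK
  have hKδ : 9 / (8 * δ) ≤ K := le_max_left _ _
  have hKl : 9 / (10 * l) ≤ K := le_max_right _ _
  have hK1 : 1 ≤ K := by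
    refine le_trans ?_ hKδ
    rw [le_div_iff₀ (by positivity)]; linarith
  have hKpos : 0 < K := by linarith
  have hKinvδ : 9 / 8 * K⁻¹ ≤ δ := by
    rw [div_le_iff₀ (by positivity)] at hKδ
    rw [← div_eq_mul_inv, div_le_iff₀ hKpos]; linarith
  have hKinvl : 9 / 8 * K⁻¹ ≤ 5 * l / 4 := by
    rw [div_le_iff₀ (by positivity)] at hKl
    rw [← div_eq_mul_inv, div_le_iff₀ hKpos]; linarith
  obtain ⟨Φ, Φi, hΦs, hΦis, hΦa, hΦb, hΦ0, hΦfar, hΦdisc⟩ := exists_blowup hK1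
  have hΦi0 : ∀ z, Φi 0 z = z := fun z => by
    conv_lhs => rw [← hΦ0 z]
    exact hΦb 0 z
  -- `Φ_t` maps the disc of radius `9/8` into itself (`t ∈ [0, 1]`), and `Φ_1` into the small discs
  have hΦnorm : ∀ t ∈ Icc (0 : ℝ) 1, ∀ z : EuclideanSpace ℝ (Fin 2), ‖z‖ ≤ 9 / 8 →
      ‖Φ t z‖ ≤ (1 - Real.smoothTransition t * (1 - K⁻¹)) * ‖z‖ := fun t ht z hz => by
    have h1 : Real.smoothTransition t * (1 - K⁻¹) ≤ 1 * (1 - K⁻¹) :=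
      mul_le_mul_of_nonneg_right (Real.smoothTransition.le_one t)
        (by rw [sub_nonneg]; exact inv_le_one_of_one_le₀ hK1)
    have h2 : 0 < K⁻¹ := inv_pos.2 hKpos
    have hnn : 0 ≤ 1 - Real.smoothTransition t * (1 - K⁻¹) := by linarith
    rw [hΦdisc t ht z hz, norm_smul, Real.norm_eq_abs, abs_of_nonneg hnn]
  have hcoef : ∀ t, 0 ≤ Real.smoothTransition t * (1 - K⁻¹) := fun t =>
    mul_nonneg (Real.smoothTransition.nonneg t) (by rw [sub_nonneg]; exact inv_le_one_of_one_le₀ hK1)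
  have hΦ98 : ∀ t ∈ Icc (0 : ℝ) 1, ∀ z : EuclideanSpace ℝ (Fin 2), ‖z‖ ≤ 9 / 8 → ‖Φ t z‖ ≤ 5 / 4 :=
    fun t ht z hz => by
    have := hΦnorm t ht z hz
    nlinarith [hcoef t, norm_nonneg z]
  have hΦ1 : ∀ z : EuclideanSpace ℝ (Fin 2), ‖z‖ ≤ 9 / 8 → ‖Φ 1 z‖ ≤ 9 / 8 * K⁻¹ := fun z hz => by
    have := hΦnorm 1 ⟨zero_le_one, le_rfl⟩ z hz
    rw [Real.smoothTransition.one, one_mul] at this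
    have h2 : 0 < K⁻¹ := inv_pos.2 hKpos
    nlinarith
  have hσI : ∀ s, Real.smoothTransition s ∈ Icc (0 : ℝ) 1 := fun s =>
    ⟨Real.smoothTransition.nonneg s, Real.smoothTransition.le_one s⟩
  -- the rescaling path `S_s = δ_{m s} ψ δ_{m s}⁻¹`, `m s = l + (1 - l) σ s`, from `ψ_l` to `ψ`
  set m : ℝ → ℝ := fun s => l + (1 - l) * Real.smoothTransition s with hm
  have hms : ContDiff ℝ ∞ m := contDiff_const.add (contDiff_const.mul Real.smoothTransition.contDiff)
  have hml : ∀ s, l ≤ m s := fun s => by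
    have : 0 ≤ (1 - l) * Real.smoothTransition s := mul_nonneg (by linarith) (Real.smoothTransition.nonneg s)
    simp only [hm]; linarith
  have hmpos : ∀ s, 0 < m s := fun s => hl.trans_le (hml s)
  have hm0 : m 0 = l := by simp [hm]
  have hm1 : m 1 = 1 := by simp only [hm, Real.smoothTransition.one, mul_one]; ring
  set S : ℝ → EuclideanSpace ℝ (Fin 2) → EuclideanSpace ℝ (Fin 2) := fun s z => m s • ψ ((m s)⁻¹ • z) with hS
  set Si : ℝ → EuclideanSpace ℝ (Fin 2) → EuclideanSpace ℝ (Fin 2) := fun s z => m s • ψ' ((m s)⁻¹ • z) with hSi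
  have hsc : ContDiff ℝ ∞ fun p : ℝ × EuclideanSpace ℝ (Fin 2) => (m p.1)⁻¹ • p.2 :=
    ((hms.comp contDiff_fst).inv fun p => (hmpos p.1).ne').smul contDiff_snd
  have hSs : ContDiff ℝ ∞ (uncurry S) := by
    show ContDiff ℝ ∞ fun p : ℝ × EuclideanSpace ℝ (Fin 2) => m p.1 • ψ ((m p.1)⁻¹ • p.2)
    exact (hms.comp contDiff_fst).smul (hψ.comp hsc)
  have hSis : ContDiff ℝ ∞ (uncurry Si) := by
    show ContDiff ℝ ∞ fun p : ℝ × EuclideanSpace ℝ (Fin 2) => m p.1 • ψ' ((m p.1)⁻¹ • p.2)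
    exact (hms.comp contDiff_fst).smul (hψ'.comp hsc)
  have hSa : ∀ s z, S s (Si s z) = z := fun s z => by
    simp only [hS, hSi, smul_smul, inv_mul_cancel₀ (hmpos s).ne', one_smul, h1, mul_inv_cancel₀ (hmpos s).ne']
  have hSb : ∀ s z, Si s (S s z) = z := fun s z => by
    simp only [hS, hSi, smul_smul, inv_mul_cancel₀ (hmpos s).ne', one_smul, h2, mul_inv_cancel₀ (hmpos s).ne']
  have hSfix : ∀ s z, ‖z‖ ≤ 5 * l / 4 → S s z = z := fun s z hz => by
    simp only [hS]
    rw [hfix, smul_smul, mul_inv_cancel₀ (hmpos s).ne', one_smul]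
    rw [norm_smul, Real.norm_eq_abs, abs_inv, abs_of_pos (hmpos s), inv_mul_le_iff₀ (hmpos s)]
    nlinarith [hml s]
  have hSfar : ∀ s z, (7 : ℝ) / 4 ≤ ‖z‖ → S s z = z := fun s z hz => by
    simp only [hS]
    rw [hsupp, smul_smul, mul_inv_cancel₀ (hmpos s).ne', one_smul]
    rw [norm_smul, Real.norm_eq_abs, abs_inv, abs_of_pos (hmpos s), le_inv_mul_iff₀ (hmpos s)]
    have hm1' : m s ≤ 1 := by
      have : (1 - l) * Real.smoothTransition s ≤ (1 - l) * 1 :=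
        mul_le_mul_of_nonneg_left (Real.smoothTransition.le_one s) (by linarith)
      simp only [hm]; linarith
    nlinarith
  -- Piece Q0: `twist (2πk)` to `Φ₁⁻¹ ∘ twist (2πk) ∘ Φ₁`
  obtain ⟨q0s, q0is, q0a, q0b, q0fix, q0far⟩ := conj_piece (P := fun _ => twist (2 * Real.pi * k))
    (Pi := fun _ => twist (-(2 * Real.pi * k))) (b := fun t => t) hΦs hΦis hΦa hΦb hΦfar
    (ContDiff.twist contDiff_const contDiff_snd) (ContDiff.twist contDiff_const contDiff_snd)
    (fun _ z => twist_twist_neg _ z) (fun _ z => twist_neg_twist _ z)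
    (fun _ z hz => by rw [twist_of_ge _ hz, rotL_two_pi_mul_int])
    Real.smoothTransition.contDiff contDiff_id
    (fun t z hz => twist_of_le _ (hΦ98 _ (hσI t) z hz))
  -- Piece Q1: `Φ₁⁻¹ ∘ F_t ∘ Φ₁`
  obtain ⟨q1s, q1is, q1a, q1b, q1fix, q1far⟩ := conj_piece (a := fun _ => (1 : ℝ)) (b := fun t => t)
    hΦs hΦis hΦa hΦb hΦfar hFs hFis hFa hFb hFfar contDiff_const contDiff_id
    (fun t z hz => hFfix t _ ((hΦ1 z hz).trans hKinvδ))
  -- Piece Q2: `Φ₁⁻¹ ∘ S_s ∘ Φ₁`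
  obtain ⟨q2s, q2is, q2a, q2b, q2fix, q2far⟩ := conj_piece (a := fun _ => (1 : ℝ)) (b := fun t => t)
    hΦs hΦis hΦa hΦb hΦfar hSs hSis hSa hSb hSfar contDiff_const contDiff_id
    (fun t z hz => hSfix t _ ((hΦ1 z hz).trans hKinvl))
  -- Piece Q3: `Φ_σ⁻¹ ∘ ψ ∘ Φ_σ`, from `ψ` to `Φ₁⁻¹ ∘ ψ ∘ Φ₁` (to be reversed)
  obtain ⟨q3s, q3is, q3a, q3b, q3fix, q3far⟩ := conj_piece (P := fun _ => ψ) (Pi := fun _ => ψ')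
    (b := fun t => t) hΦs hΦis hΦa hΦb hΦfar (hψ.comp contDiff_snd) (hψ'.comp contDiff_snd)
    (fun _ z => h1 z) (fun _ z => h2 z) (fun _ z hz => hsupp z hz)
    Real.smoothTransition.contDiff contDiff_id
    (fun t z hz => hfix _ (hΦ98 _ (hσI t) z hz))
  obtain ⟨q3s', q3is'⟩ := iso_symm q3s q3is
  -- concatenate: Q0 ⋆ Q1 ⋆ Q2 ⋆ Q3⁻
  obtain ⟨G₁, G₁i, g₁s, g₁is, g₁a, g₁b, g₁fix, g₁far, g₁0, g₁1⟩ :=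
    iso_trans q0s q0is q0a q0b q0fix q0far q1s q1is q1a q1b q1fix q1far (fun z => by
      simp only [Real.smoothTransition.one, hF0])
  obtain ⟨G₂, G₂i, g₂s, g₂is, g₂a, g₂b, g₂fix, g₂far, g₂0, g₂1⟩ :=
    iso_trans g₁s g₁is g₁a g₁b g₁fix g₁far q2s q2is q2a q2b q2fix q2far (fun z => by
      rw [g₁1]; simp only [hF1, hS, hm0])
  obtain ⟨G₃, G₃i, g₃s, g₃is, g₃a, g₃b, g₃fix, g₃far, g₃0, g₃1⟩ :=
    iso_trans g₂s g₂is g₂a g₂b g₂fix g₂far q3s' q3is'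
      (fun t z => q3a (1 - t) z) (fun t z => q3b (1 - t) z)
      (fun t z hz => q3fix (1 - t) z hz) (fun t z hz => q3far (1 - t) z hz) (fun z => by
      rw [g₂1]; simp only [hS, hm1, inv_one, one_smul, sub_zero, Real.smoothTransition.one])
  -- reverse, and read off the ends
  obtain ⟨gs, gis⟩ := iso_symm g₃s g₃is
  refine ⟨k, fun t z => G₃ (1 - t) z, fun t z => G₃i (1 - t) z, gs, gis,
    fun t z => g₃a (1 - t) z, fun t z => g₃b (1 - t) z, fun z => ?_, fun z => ?_,
    fun t z hz => g₃fix (1 - t) z hz, fun t z hz => g₃far (1 - t) z hz⟩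
  · simp only [sub_zero, g₃1, sub_self, Real.smoothTransition.zero, hΦ0, hΦi0]
  · simp only [sub_self, g₃0, g₂0, g₁0, Real.smoothTransition.zero, hΦ0, hΦi0]
    exact twist_apply_coord _ z

end Summit.SmoothPoincare4.SmoothPoincare4.Cruxes.RungOne.Sketch

end
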